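import Summits.QuantumFields.YangMills.Theorems.BalabanUVNodesN18EndAtW1Carriers
import Summits.QuantumFields.YangMills.Theorems.BalabanUVNodesRateReadingOfRecord12
import Literature.MathematicalPhysics.QuantumFieldTheory.Balaban1983to89.Node00.RateRecordW1Maps

/-!
# BalabanUVNodes ∕ node N18 = NE5 — N18 AT THE RATE READING OF RECORD `YMDAG.UVSplit.readingOfRecord₁₂ w1 ℓ₃ ne2 ne1` (dag-n22-e, edition 1) AND AT
# W1's READING DATA OF RECORD `Node00.W1.ReadingData.ofRecord` (node00-def-W1 g3: the domain pairing `pairOfRecord`, run B on `F.P (k+1)`, both runs read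
# through `ιSU N` with `𝐉 = 0`) WITH THE TRANSPORT OF RECORD PINNED SUMMITS-SIDE: `T₀ := B13Carriers.transportRaw F k (Node00.avOfRecord F N (k+1) 0)` — Bałaban's
# (0.4) block averaging exp[mean log] followed by the level identification (Track A, DAG node N18 = `T4OutputRate.NE5` :211; cluster K4 «SpineRates», item K3′
# `SpineGivenEndpointR12`; module 10 of seat pub-ymgap-dag-n18-d, strategy s2)

HONEST FRAMING.  Count-neutral kernel bookkeeping (`--supports stmt-QuantumFields-19908 --as helper`).  NE5 is NOT PRINTED and NOT proved; N18 is NOT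
discharged.  «A skeleton quoting `S_N18 (RRec₁₂ 𝔯)` NAMES its `𝔯`» — this file names it as far as the tree's definers have pinned it tonight and reads N18
there: dag-n22-e's `readingOfRecord₁₂ w1 ℓ₃ ne2 ne1 := RateReading₁₂.ofAssignment (W1.assignment₁₂ (pinnedInputs₁₂ w1 ℓ₃ ne2)) ne1`
(`Thm/BalabanUVNodesRateReadingOfRecord12`, so modules 8 ∕ 9 apply to it BY `rfl`), with W1's reading data `w1` further PINNED to node00-def-W1 g3's
`ReadingData.ofRecord F θ.τ9.M N (S F θ) (gauge F θ) (hg F θ) T₀ (li F θ)` (`Node00/RateRecordW1Maps` p473218: the level pairings OF RECORD — run A on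
`F.P k`, run B on `F.P (k+1)`, `embA ∕ embB := Sect2.ofBackgroundC (ιSU N)`, `pair := W1.pairOfRecord F M k` — with the towers `S`, the closeness gauge,
the transport and the letter inputs as parameters) and the transport parameter PINNED HERE, where its object lives (Summits), to THE TRANSPORT OF RECORD
`T₀ F θ k := transportRaw F k (Node00.avOfRecord F N (k+1) 0)` (`Node00.avOfRecord = BlockAveraging.blockAvg ExpMeanLog.expMeanLogSU`, [I] (0.4) p.253; module
7 §8: at every Stage-12 datum key this IS the datum-keyed two-run carriers' transport; LENS card T1 (a) «fix T₀ and say so»).  What is proved: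
* §1 at `readingOfRecord₁₂ w1 ℓ₃ ne2 ne1`, any `w1`: `S_N18` does NOT read `ℓ₃ ∕ ne2 ∕ ne1` (`s_N18_readingOfRecord₁₂_irrel`); the closed form in `w1`'s currency
  (`s_N18_readingOfRecord₁₂_iff_w1` = module 8's `s_N18_rRec₁₂_w1_iff` by `rfl`); THE ROW ON THE READING's OWN CARRIERS (`s_N18_readingOfRecord₁₂_of_envelopeOnW1Carriers`
  = module 9 §4 by `rfl`).
* §2 at THE READING OF RECORD (`w1 := ReadingData.ofRecord … (T₀ of record) …`): PER LEVEL `n18At_readingOfRecord_iff` (`Iff.rfl`) and IN CLOSED FORM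
  `s_N18_readingOfRecord₁₂_ofRecord_iff` — `S_N18 (RRec₁₂ 𝔯_record)` ⇔ for every family `F`, datum of record `D` with Stage-12 key `h` (`θ := h.params`), run
  length `k`, member `b ∈ ]0, θ.γ]`, history `g ∈ ]0, θ.γ]^ℕ`, run-B gauge field `U` on the fine lattice of `F.P (k+1)` and run-A domain `(j, X)`:
  `|Re E^{(j)}_{S_k}(X; g; (ι(M̄U), 0)) − Re E^{(j+1)}_{S_{k+1}}(πX; b∷g; (ιU, 0))| ≤ C₅ · θ₅ ^ j · e^{−κ·d_j(X)}`, `M̄U := transportRaw F k (avOfRecord F N (k+1) 0) U`,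
  `πX := pairOfRecord F θ.τ9.M k (j, X)` — N18's statement of record with EVERY map pinned; residual: the towers `S` (the (2.14) terms — N10's Lemmas 1–3
  objects), the closeness gauge (N16's currency; N18 does not read it), the letter inputs `li`.
* §3 THE ROW AT THE READING OF RECORD (`s_N18_readingOfRecord₁₂_ofRecord_of_envelopeOnW1Carriers`): per admissible tuple with provisos and run length, per-member
  step models OVER `(LevelPairing.ofRecord F θ.τ9.M k N (gauge F θ k) (hg F θ k) (T₀ of record)).carriers` representing (2.13) of activities on the `k`-th torus's
  catalogue with THE NODE-A MAJORANT AS HYPOTHESIS, the leaves ON THE FUNCTIONALS OF RECORD (run A: `W1.functional (S F θ k) (ιSU N) _` by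
  `LevelPairing.EA_ofRecord`; run B: `Re E^{(j+1)}_{S_{k+1}}(π·; b∷·; (ι·, 0))`), the located numerals, letters dominated ⇒ `S_N18 (RRec₁₂ 𝔯_record)` — module 9 §3
  once per key and level; NO map, NO identification clause, NO transport parameter.
* §4 HONESTY (`s_N18_readingOfRecord₁₂_ofRecord_termless`): with every map and the transport pinned the statement is still about the TOWERS — for W1's termless
  towers it holds outright (`functionalC_termlessTower`); a skeleton quoting it NAMES its towers.
What REMAINS for N18 at the reading of record: the H-layer ACTIVITY DATUM on the record's torus catalogue for the towers OF RECORD (dag-n18-c s1) + NODE A's (2.38)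
+ NODE O's leaves + rows NE2 ∕ NE3's L07 ∕ L08; the towers' identification with the (2.14) terms (definer ∕ NODE O); K0′.  One finite four-torus programme at
fixed `ε`; NOT the continuum limit, NOT OS, NOT a mass gap, NOT Clay.  0 `def`, 0 `sorry`.

Sources: T. Bałaban, CMP **109** (1987) [Balaban1987RG1] (0.4) p. 253, (0.8)–(0.10) p. 253, (0.24)–(0.25) p. 257, Thm 1 p. 259, (1.18) p. 263; CMP **116**
(1988) [Balaban1988RG2Cluster] (2.13)–(2.14) pp. 14–15, Lemma 3 (2.38) p. 20; CMP **119** (1988) [Balaban1988Convergent] (2.27) p. 259.  Nothing here is a claim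
about the Yang–Mills mass gap.
-/

noncomputable section

open Set Metric

namespace YMDAG.N18.W1Reading

open Literature.MathematicalPhysics.QuantumFieldTheory.Balaban1983to89
open Literature.MathematicalPhysics.QuantumFieldTheory.Balaban1983to89.T4Continuum
open Literature.MathematicalPhysics.QuantumFieldTheory.Balaban1983to89.T4OutputRate (Carriers Functional NE5 Window)
open Literature.MathematicalPhysics.QuantumFieldTheory.Balaban1983to89.T4InputCauchyRateData (StepModel)
open Literature.MathematicalPhysics.QuantumFieldTheory.Balaban1983to89.B13Resummation (locE)
open Literature.MathematicalPhysics.QuantumFieldTheory.Balaban1983to89.TreeLengthTorus (TDom tsys torusTreeLen)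
open Literature.MathematicalPhysics.QuantumFieldTheory.Balaban1983to89.TreeLengthTorusGeometry (TTouch)
open Literature.MathematicalPhysics.QuantumFieldTheory.Balaban1983to89.B12TreeDecay (K₀)
open Literature.MathematicalPhysics.QuantumFieldTheory.Balaban1983to89.Node00 (Stage12Params IsDatumOfRecord₁₂C U3Letters₁₁ U3Objects₁₁ NE2Objects₁₁
  NE3Letters₁₁ RateAssignment₁₂ prependCoupling MatA ιSU avOfRecord)
open Literature.MathematicalPhysics.QuantumFieldTheory.Balaban1983to89.Node00.Sect2 (domCount domSys ofBackgroundC)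
open Literature.MathematicalPhysics.QuantumFieldTheory.Balaban1983to89.Node00.W1 (ReadingData LevelPairing LetterInputs ClusterTower pairOfRecord
  functionalC functional)
open Summit.QuantumFields.BalabanUV.T4Continuum.B13Carriers (transportRaw)
open Summit.QuantumFields.BalabanUV.T4Continuum.Spine.NE5
open YMDAG.N18.HLayer
open YMDAG.UVSplit

variable {N : ℕ} [NeZero N]

/-! ## §1 At the reading of record, edition 1, for ANY W1 reading data `w1` -/

section Edition1

variable (w1 : (F : T4Family) → (θ : Stage12Params F N) → ReadingData F (MatA N) θ.τ9.M) (ℓ₃ : T4Family → NE3Letters₁₁)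
  (ne2 : (F : T4Family) → Stage12Params F N → (ℕ → ℝ) → List (ULoop F) → ℕ → NE2Objects₁₁)
  (ne1 : (F : T4Family) → Stage12Params F N → (ℕ → ℝ) → List (ULoop F) → NE1pCarriers)

/-- **N18 AT THE READING OF RECORD DOES NOT READ THE OTHER NODES' COMPONENTS** [bookkeeping]: `S_N18 (RRec₁₂ (readingOfRecord₁₂ w1 ℓ₃ ne2 ne1))` is the same
statement for every NE3 letter table `ℓ₃`, NE2 layer `ne2` and dressed tower `ne1` (module 8's `s_N18_rRec₁₂_congr_u3`). [cite: Balaban1987RG1, Thm 1 p.259] -/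
theorem s_N18_readingOfRecord₁₂_irrel (ℓ₃' : T4Family → NE3Letters₁₁)
    (ne2' : (F : T4Family) → Stage12Params F N → (ℕ → ℝ) → List (ULoop F) → ℕ → NE2Objects₁₁)
    (ne1' : (F : T4Family) → Stage12Params F N → (ℕ → ℝ) → List (ULoop F) → NE1pCarriers) :
    S_N18 (RRec₁₂ (readingOfRecord₁₂ w1 ℓ₃ ne2 ne1)) ↔ S_N18 (RRec₁₂ (readingOfRecord₁₂ w1 ℓ₃' ne2' ne1')) :=
  s_N18_rRec₁₂_congr_u3 fun _ _ _ _ _ => rfl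

/-- **N18 AT THE READING OF RECORD, IN `w1`'s CURRENCY** [bookkeeping; module 8's `s_N18_rRec₁₂_w1_iff` at `𝔇 := pinnedInputs₁₂ w1 ℓ₃ ne2`, by `rfl`]: for every
datum key `h`, run length `k`, member `b ∈ ]0, θ.γ]` (`θ := h.params`), history `g ∈ ]0, θ.γ]^ℕ`, run-B background `U` and run-A domain `(j, X)`,
`|Re E_A^{(j)}(X; g; embA (transport U)) − Re E_B(pair (j, X); b∷g; embB U)| ≤ C₅ · θ₅ ^ j · e^{−κ·d_j(X)}` for the (2.13) terms of `w1`'s towers through `w1`'s pairings.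
[cite: Balaban1987RG1, Thm 1 p.259 and (1.18) p.263; Balaban1988RG2Cluster, (2.13) p.14] -/
theorem s_N18_readingOfRecord₁₂_iff_w1 :
    S_N18 (RRec₁₂ (readingOfRecord₁₂ w1 ℓ₃ ne2 ne1)) ↔
      ∀ (F : T4Family) (D : Datum F N) (h : IsDatumOfRecord₁₂C F N D) (k : ℕ) (b : ℝ), 0 < b → b ≤ h.params.γ →
        ∀ g ∈ Window h.params.γ, ∀ (U : ((w1 F h.params).pairing k).BgB) (X : Node00.W1.Dom (F.P k) h.params.τ9.M),
          |(functionalC ((w1 F h.params).S k) g (((w1 F h.params).pairing k).embA (((w1 F h.params).pairing k).transport U)) X).re -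
              (functionalC ((w1 F h.params).S (k + 1)) (prependCoupling b g) (((w1 F h.params).pairing k).embB U)
                (((w1 F h.params).pairing k).pair X)).re| ≤
            (w1 F h.params).li.C₅ * (w1 F h.params).li.θ₅ ^ X.1 *
              Real.exp (-((w1 F h.params).li.κ * (domSys (F.P k) h.params.τ9.M X.1).dj X.2)) :=
  s_N18_rRec₁₂_w1_iff (pinnedInputs₁₂ w1 ℓ₃ ne2) ne1

open Classical in
/-- **THE ROW AT THE READING OF RECORD, ON THE READING's OWN CARRIERS** [bookkeeping; module 9 §4 at `𝔇 := pinnedInputs₁₂ w1 ℓ₃ ne2`, by `rfl`]: at every admissible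
Stage-12 tuple with provisos and every run length `k`, per-member step models OVER `((w1 F θ).pairing k).carriers` whose outputs ARE (2.13) of activities on the `k`-th
torus's catalogue (`hrep`) with THE NODE-A MAJORANT AS HYPOTHESIS (`hH`, [II] Lemma 3 (2.38), instanced by nobody), the leaves ON `w1`'s OWN FUNCTIONALS
`(pairing k).EA (S k)` ∕ `(pairing k).EB (S (k+1)) b`, the located numerals, the [KP86] clause, L10, the sharp clause, and `w1`'s letters dominating the END's ⇒
`S_N18 (RRec₁₂ (readingOfRecord₁₂ w1 ℓ₃ ne2 ne1))`. [cite: Balaban1988RG2Cluster, Lemma 3 (2.38) p.20 and (2.13) p.14; Balaban1987RG1, Thm 1 p.259] -/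
theorem s_N18_readingOfRecord₁₂_of_envelopeOnW1Carriers
    (h : ∀ (F : T4Family) (θ : Stage12Params F N), θ.Provisos₁₂ F N → θ.Admissible F N → ∀ k : ℕ,
      ∃ (Op : Type) (_ : NormedAddCommGroup Op) (_ : NormedSpace ℂ Op) (Hist : Type) (_ : NormedAddCommGroup Hist) (_ : NormedSpace ℂ Hist)
        (Mb : ℝ → StepModel ((w1 F θ).pairing k).carriers Op Hist)
        (act : ℝ → (j : ℕ) → Op × Hist → TDom 4 (domCount (F.P k) θ.τ9.M j) → ℂ) (W : Set (ℕ → ℝ)) (γ' C3 ε₁ Rd κ : ℝ)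
        (EA₀ E₀ E₁ δ δ' θr θ' cH ω ρ₀ B : ℝ) (k₀ : ℕ),
        (∀ b : ℝ, 0 < b → b ≤ γ' → ∀ (X : Node00.W1.Dom (F.P k) θ.τ9.M) (z : Op × Hist),
          (Mb b).Out X.1 z.1 z.2 X =
            locE (TTouch (d := 4) (N := domCount (F.P k) θ.τ9.M X.1)) (fun Z : (tsys 4 (domCount (F.P k) θ.τ9.M X.1)).Dom => Z.1)
              (act b X.1 z) X.2.1) ∧
        0 ≤ C3 ∧ 0 ≤ ε₁ ∧ 0 ≤ κ ∧ κ + 2 * (64 * Real.log 162) + 2 ≤ Rd ∧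
        C3 * ε₁ * Real.exp (5 * κ + 1) * K₀ 64 8 * 9 * 64 ≤ 1 ∧
        (∀ b : ℝ, 0 < b → b ≤ γ' → ∀ j, ∀ g ∈ W, ∀ (U : ((w1 F θ).pairing k).BgB) (q : Op × Hist), q ∈ (Mb b).Base j g U →
          ∃ V : Set (Op × Hist), IsOpen V ∧ (Mb b).box j q ⊆ V ∧
            (∀ Z : TDom 4 (domCount (F.P k) θ.τ9.M j), DifferentiableOn ℂ (fun z : Op × Hist => act b j z Z) V) ∧
            (∀ z ∈ V, ∀ Z : TDom 4 (domCount (F.P k) θ.τ9.M j), ‖act b j z Z‖ ≤ C3 * ε₁ * Real.exp (-(Rd * torusTreeLen Z.1)))) ∧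
        (∀ b : ℝ, 0 < b → b ≤ γ' → L01 (Mb b) (((w1 F θ).pairing k).EA ((w1 F θ).S k)) W) ∧
        (∀ b : ℝ, 0 < b → b ≤ γ' → L02 (Mb b) (((w1 F θ).pairing k).EB ((w1 F θ).S (k + 1)) b) W) ∧
        (∀ b : ℝ, 0 < b → b ≤ γ' → L03 (Mb b) (((w1 F θ).pairing k).EB ((w1 F θ).S (k + 1)) b) W) ∧
        L05 (((w1 F θ).pairing k).EA ((w1 F θ).S k)) W EA₀ κ ∧
        (∀ b : ℝ, 0 < b → b ≤ γ' → L06 (((w1 F θ).pairing k).EB ((w1 F θ).S (k + 1)) b) W E₀ κ) ∧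
        (∀ b : ℝ, 0 < b → b ≤ γ' → L07 (Mb b) W δ θr) ∧ (∀ b : ℝ, 0 < b → b ≤ γ' → L08 (Mb b) W κ E₀ δ' θr) ∧
        (∀ b : ℝ, 0 < b → b ≤ γ' → L09aff (Mb b) W) ∧ (∀ b : ℝ, 0 < b → b ≤ γ' → L09blind (Mb b) W) ∧
        (∀ b : ℝ, 0 < b → b ≤ γ' → L09hom (Mb b) W) ∧ (∀ b : ℝ, 0 < b → b ≤ γ' → L09unit (Mb b) W κ E₁ cH ω) ∧
        0 < E₁ ∧ 0 ≤ δ + δ' ∧ 0 ≤ θr ∧ θr ≤ θ' ∧ θ' ≤ 1 ∧ 0 ≤ cH ∧ 0 < ω ∧ ρ₀ < 1 ∧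
        (δ + δ') * θr ^ k₀ + cH * (EA₀ + E₀) / (1 - ω) ≤ ρ₀ ∧ 0 ≤ B ∧ (∀ k < k₀, EA₀ + E₀ ≤ B * θr ^ k) ∧
        Real.exp 1 * 9 * 64 * K₀ 64 8 ^ 2 * C3 * cH * ε₁ < (θ' - ω) * (1 - ρ₀) ∧
        Window θ.γ ⊆ W ∧ θ.γ ≤ γ' ∧ (w1 F θ).li.κ ≤ κ ∧ θ' ≤ (w1 F θ).li.θ₅ ∧
        (Real.exp 1 * 9 * 64 * K₀ 64 8 ^ 2 * (C3 * ε₁) / (1 - ρ₀) * (δ + δ') + B) * (θ' - ω) /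
            (θ' - (ω + Real.exp 1 * 9 * 64 * K₀ 64 8 ^ 2 * (C3 * ε₁) / (1 - ρ₀) * cH)) ≤ (w1 F θ).li.C₅) :
    S_N18 (RRec₁₂ (readingOfRecord₁₂ w1 ℓ₃ ne2 ne1)) :=
  s_N18_rRec₁₂_w1_of_envelopeOnW1Carriers (pinnedInputs₁₂ w1 ℓ₃ ne2) ne1 h

end Edition1

/-! ## §2 At W1's reading data OF RECORD with the transport OF RECORD: N18's statement of record with every map pinned -/

section OfRecord

variable (S : (F : T4Family) → (θ : Stage12Params F N) → (k : ℕ) → ClusterTower (F.P k) (MatA N) θ.τ9.M)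
  (gauge : (F : T4Family) → (θ : Stage12Params F N) → (k : ℕ) → GaugeField (F.P k) 0 (Node00.SU N) → GaugeField (F.P k) 0 (Node00.SU N) → ℝ)
  (hg : ∀ (F : T4Family) (θ : Stage12Params F N) (k : ℕ) (U U' : GaugeField (F.P k) 0 (Node00.SU N)), 0 ≤ gauge F θ k U U')
  (li : (F : T4Family) → Stage12Params F N → LetterInputs) (ℓ₃ : T4Family → NE3Letters₁₁)
  (ne2 : (F : T4Family) → Stage12Params F N → (ℕ → ℝ) → List (ULoop F) → ℕ → NE2Objects₁₁)
  (ne1 : (F : T4Family) → Stage12Params F N → (ℕ → ℝ) → List (ULoop F) → NE1pCarriers)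

/-- **PER LEVEL AT THE READING OF RECORD, `Iff.rfl`**: N18 at the level-`k` bundle of the reading data of record with the transport of record IS: for every member
`b ∈ ]0, θ.γ]`, history `g ∈ ]0, θ.γ]^ℕ`, run-B gauge field `U : GaugeField (F.P (k+1)) 0 (Node00.SU N)` and run-A domain `(j, X)`,
`|Re E^{(j)}_{S_k}(X; g; (ι(transportRaw F k (avOfRecord F N (k+1) 0) U), 0)) − Re E^{(j+1)}_{S_{k+1}}(pairOfRecord (j, X); b∷g; (ιU, 0))| ≤ C₅ · θ₅ ^ j · e^{−κ·d_j(X)}`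
(node00-def-W1 g3's `ReadingData.ne5_ofRecord_iff` member by member). [cite: Balaban1987RG1, (0.4) p.253, (0.24)–(0.25) p.257, Thm 1 p.259 and (1.18) p.263; Balaban1988RG2Cluster, (2.13) p.14] -/
theorem n18At_readingOfRecord_iff (F : T4Family) (θ : Stage12Params F N) (k : ℕ) :
    N18At (u3OfRecord₁₂ θ ((ReadingData.ofRecord F θ.τ9.M N (S F θ) (gauge F θ) (hg F θ)
      (fun k => transportRaw F k (avOfRecord F N (k + 1) 0)) (li F θ)).u3Objects θ.γ) k) ↔
      ∀ b : ℝ, 0 < b → b ≤ θ.γ → ∀ g ∈ Window θ.γ, ∀ (U : GaugeField (F.P (k + 1)) 0 (Node00.SU N)) (X : Node00.W1.Dom (F.P k) θ.τ9.M),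
        |(functionalC (S F θ k) g (ofBackgroundC (ιSU N) (transportRaw F k (avOfRecord F N (k + 1) 0) U)) X).re -
            (functionalC (S F θ (k + 1)) (prependCoupling b g) (ofBackgroundC (ιSU N) U) (pairOfRecord F θ.τ9.M k X)).re| ≤
          (li F θ).C₅ * (li F θ).θ₅ ^ X.1 * Real.exp (-((li F θ).κ * (domSys (F.P k) θ.τ9.M X.1).dj X.2)) :=
  Iff.rfl

/-- **N18's STATEMENT OF RECORD WITH EVERY MAP PINNED, IN CLOSED FORM** [bookkeeping]: at the reading of record whose U3 objects are the W1 reading data OF RECORD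
with THE TRANSPORT OF RECORD `U ↦ transportRaw F k (avOfRecord F N (k+1) 0) U` ((0.4) block averaging exp[mean log] + level identification),
`S_N18 (RRec₁₂ 𝔯_record)` ⇔ for every family `F`, datum of record `D` with Stage-12 key `h` (`θ := h.params`), run length `k`, member `b ∈ ]0, θ.γ]`, history
`g ∈ ]0, θ.γ]^ℕ`, run-B gauge field `U` on the fine lattice of `F.P (k+1)` and run-A domain `(j, X)` of the `k`-th torus's catalogue:
`|Re E^{(j)}_{S_k}(X; g; (ι M̄U, 0)) − Re E^{(j+1)}_{S_{k+1}}(πX; b∷g; (ιU, 0))| ≤ C₅ · θ₅ ^ j · e^{−κ·d_j(X)}`.  Residual: the towers `S` (the (2.14) terms), the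
closeness gauge (unread by N18), the letter inputs.  NOT PRINTED; NOT proved. [cite: Balaban1987RG1, (0.4) p.253, (0.24)–(0.25) p.257, Thm 1 p.259 and (1.18) p.263; Balaban1988RG2Cluster, (2.13) p.14] -/
theorem s_N18_readingOfRecord₁₂_ofRecord_iff :
    S_N18 (RRec₁₂ (readingOfRecord₁₂ (fun F θ => ReadingData.ofRecord F θ.τ9.M N (S F θ) (gauge F θ) (hg F θ)
      (fun k => transportRaw F k (avOfRecord F N (k + 1) 0)) (li F θ)) ℓ₃ ne2 ne1)) ↔
      ∀ (F : T4Family) (D : Datum F N) (h : IsDatumOfRecord₁₂C F N D) (k : ℕ) (b : ℝ), 0 < b → b ≤ h.params.γ →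
        ∀ g ∈ Window h.params.γ, ∀ (U : GaugeField (F.P (k + 1)) 0 (Node00.SU N)) (X : Node00.W1.Dom (F.P k) h.params.τ9.M),
          |(functionalC (S F h.params k) g (ofBackgroundC (ιSU N) (transportRaw F k (avOfRecord F N (k + 1) 0) U)) X).re -
              (functionalC (S F h.params (k + 1)) (prependCoupling b g) (ofBackgroundC (ιSU N) U) (pairOfRecord F h.params.τ9.M k X)).re| ≤
            (li F h.params).C₅ * (li F h.params).θ₅ ^ X.1 * Real.exp (-((li F h.params).κ * (domSys (F.P k) h.params.τ9.M X.1).dj X.2)) :=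
  s_N18_rRec₁₂_w1_iff (pinnedInputs₁₂ (fun F θ => ReadingData.ofRecord F θ.τ9.M N (S F θ) (gauge F θ) (hg F θ)
    (fun k => transportRaw F k (avOfRecord F N (k + 1) 0)) (li F θ)) ℓ₃ ne2) ne1

/-- **WHAT IT HANDS BACK AT A DATUM KEY** [bookkeeping]: the η-rate inequality for the (2.13) terms of the towers of record, read through `ιSU`, the transport of
record and the domain pairing of record, at the canonical parameter. [cite: Balaban1987RG1, Thm 1 p.259 and (1.18) p.263] -/
theorem rate_of_s_N18_readingOfRecord₁₂_ofRecord
    (hS : S_N18 (RRec₁₂ (readingOfRecord₁₂ (fun F θ => ReadingData.ofRecord F θ.τ9.M N (S F θ) (gauge F θ) (hg F θ)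
      (fun k => transportRaw F k (avOfRecord F N (k + 1) 0)) (li F θ)) ℓ₃ ne2 ne1)))
    {F : T4Family} {D : Datum F N} (hk : IsDatumOfRecord₁₂C F N D) (k : ℕ) {b : ℝ} (hb : 0 < b) (hbγ : b ≤ hk.params.γ) {g : ℕ → ℝ}
    (hgW : g ∈ Window hk.params.γ) (U : GaugeField (F.P (k + 1)) 0 (Node00.SU N)) (X : Node00.W1.Dom (F.P k) hk.params.τ9.M) :
    |(functionalC (S F hk.params k) g (ofBackgroundC (ιSU N) (transportRaw F k (avOfRecord F N (k + 1) 0) U)) X).re -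
        (functionalC (S F hk.params (k + 1)) (prependCoupling b g) (ofBackgroundC (ιSU N) U) (pairOfRecord F hk.params.τ9.M k X)).re| ≤
      (li F hk.params).C₅ * (li F hk.params).θ₅ ^ X.1 * Real.exp (-((li F hk.params).κ * (domSys (F.P k) hk.params.τ9.M X.1).dj X.2)) :=
  (s_N18_readingOfRecord₁₂_ofRecord_iff S gauge hg li ℓ₃ ne2 ne1).1 hS F D hk k b hb hbγ g hgW U X

/-! ## §3 The row at the reading of record with the maps and the transport of record -/

open Classical in
/-- **THE ROW AT THE READING OF RECORD — NO MAP, NO IDENTIFICATION CLAUSE, NO TRANSPORT PARAMETER** [bookkeeping]: if at EVERY admissible Stage-12 tuple `θ` with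
provisos and every run length `k` there are data spaces and per-member step models OVER THE CARRIERS OF THE LEVEL PAIRING OF RECORD
`(LevelPairing.ofRecord F θ.τ9.M k N (gauge F θ k) (hg F θ k) (transportRaw F k (avOfRecord F N (k+1) 0))).carriers` whose outputs ARE (2.13) of activities on the
`k`-th torus's catalogue (`hrep`) with THE NODE-A MAJORANT AS HYPOTHESIS (`hH`), the leaves L01–L03 ∕ L05–L09unit ON THE FUNCTIONALS OF RECORD — run A's
`(LevelPairing.ofRecord …).EA (S F θ k) = W1.functional (S F θ k) (ιSU N) _` (`(g, U, (j,X)) ↦ Re E^{(j)}(X; g; (ιU, 0))`, `LevelPairing.EA_ofRecord`) and run B's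
`(LevelPairing.ofRecord …).EB (S F θ (k+1)) b` (`(g, U, (j,X)) ↦ Re E^{(j+1)}(π(j,X); b∷g; (ιU, 0))`) — the located numerals, the [KP86] clause, L10, the sharp clause and
the letters `li F θ` dominating the END's, then `S_N18` holds at the reading of record — module 9 §3 once per key and level.  The hypothesis is exactly the
H-layer ACTIVITY DATUM on the record's torus catalogue for the towers of record + rows NE2 ∕ NE3's rates; nothing of it is supplied here.
[cite: Balaban1988RG2Cluster, Lemma 3 (2.38) p.20 and (2.13) p.14; Balaban1987RG1, (0.4) p.253, (0.24)–(0.25) p.257 and Thm 1 p.259] -/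
theorem s_N18_readingOfRecord₁₂_ofRecord_of_envelopeOnW1Carriers
    (h : ∀ (F : T4Family) (θ : Stage12Params F N), θ.Provisos₁₂ F N → θ.Admissible F N → ∀ k : ℕ,
      ∃ (Op : Type) (_ : NormedAddCommGroup Op) (_ : NormedSpace ℂ Op) (Hist : Type) (_ : NormedAddCommGroup Hist) (_ : NormedSpace ℂ Hist)
        (Mb : ℝ → StepModel (LevelPairing.ofRecord F θ.τ9.M k N (gauge F θ k) (hg F θ k)
          (transportRaw F k (avOfRecord F N (k + 1) 0))).carriers Op Hist)
        (act : ℝ → (j : ℕ) → Op × Hist → TDom 4 (domCount (F.P k) θ.τ9.M j) → ℂ) (W : Set (ℕ → ℝ)) (γ' C3 ε₁ Rd κ : ℝ)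
        (EA₀ E₀ E₁ δ δ' θr θ' cH ω ρ₀ B : ℝ) (k₀ : ℕ),
        (∀ b : ℝ, 0 < b → b ≤ γ' → ∀ (X : Node00.W1.Dom (F.P k) θ.τ9.M) (z : Op × Hist),
          (Mb b).Out X.1 z.1 z.2 X =
            locE (TTouch (d := 4) (N := domCount (F.P k) θ.τ9.M X.1)) (fun Z : (tsys 4 (domCount (F.P k) θ.τ9.M X.1)).Dom => Z.1)
              (act b X.1 z) X.2.1) ∧
        0 ≤ C3 ∧ 0 ≤ ε₁ ∧ 0 ≤ κ ∧ κ + 2 * (64 * Real.log 162) + 2 ≤ Rd ∧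
        C3 * ε₁ * Real.exp (5 * κ + 1) * K₀ 64 8 * 9 * 64 ≤ 1 ∧
        (∀ b : ℝ, 0 < b → b ≤ γ' → ∀ j, ∀ g ∈ W, ∀ (U : GaugeField (F.P (k + 1)) 0 (Node00.SU N)) (q : Op × Hist), q ∈ (Mb b).Base j g U →
          ∃ V : Set (Op × Hist), IsOpen V ∧ (Mb b).box j q ⊆ V ∧
            (∀ Z : TDom 4 (domCount (F.P k) θ.τ9.M j), DifferentiableOn ℂ (fun z : Op × Hist => act b j z Z) V) ∧
            (∀ z ∈ V, ∀ Z : TDom 4 (domCount (F.P k) θ.τ9.M j), ‖act b j z Z‖ ≤ C3 * ε₁ * Real.exp (-(Rd * torusTreeLen Z.1)))) ∧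
        (∀ b : ℝ, 0 < b → b ≤ γ' → L01 (Mb b)
          ((LevelPairing.ofRecord F θ.τ9.M k N (gauge F θ k) (hg F θ k) (transportRaw F k (avOfRecord F N (k + 1) 0))).EA (S F θ k)) W) ∧
        (∀ b : ℝ, 0 < b → b ≤ γ' → L02 (Mb b)
          ((LevelPairing.ofRecord F θ.τ9.M k N (gauge F θ k) (hg F θ k) (transportRaw F k (avOfRecord F N (k + 1) 0))).EB (S F θ (k + 1)) b) W) ∧
        (∀ b : ℝ, 0 < b → b ≤ γ' → L03 (Mb b)
          ((LevelPairing.ofRecord F θ.τ9.M k N (gauge F θ k) (hg F θ k) (transportRaw F k (avOfRecord F N (k + 1) 0))).EB (S F θ (k + 1)) b) W) ∧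
        L05 ((LevelPairing.ofRecord F θ.τ9.M k N (gauge F θ k) (hg F θ k) (transportRaw F k (avOfRecord F N (k + 1) 0))).EA (S F θ k)) W EA₀ κ ∧
        (∀ b : ℝ, 0 < b → b ≤ γ' →
          L06 ((LevelPairing.ofRecord F θ.τ9.M k N (gauge F θ k) (hg F θ k) (transportRaw F k (avOfRecord F N (k + 1) 0))).EB (S F θ (k + 1)) b) W E₀ κ) ∧
        (∀ b : ℝ, 0 < b → b ≤ γ' → L07 (Mb b) W δ θr) ∧ (∀ b : ℝ, 0 < b → b ≤ γ' → L08 (Mb b) W κ E₀ δ' θr) ∧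
        (∀ b : ℝ, 0 < b → b ≤ γ' → L09aff (Mb b) W) ∧ (∀ b : ℝ, 0 < b → b ≤ γ' → L09blind (Mb b) W) ∧
        (∀ b : ℝ, 0 < b → b ≤ γ' → L09hom (Mb b) W) ∧ (∀ b : ℝ, 0 < b → b ≤ γ' → L09unit (Mb b) W κ E₁ cH ω) ∧
        0 < E₁ ∧ 0 ≤ δ + δ' ∧ 0 ≤ θr ∧ θr ≤ θ' ∧ θ' ≤ 1 ∧ 0 ≤ cH ∧ 0 < ω ∧ ρ₀ < 1 ∧
        (δ + δ') * θr ^ k₀ + cH * (EA₀ + E₀) / (1 - ω) ≤ ρ₀ ∧ 0 ≤ B ∧ (∀ k < k₀, EA₀ + E₀ ≤ B * θr ^ k) ∧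
        Real.exp 1 * 9 * 64 * K₀ 64 8 ^ 2 * C3 * cH * ε₁ < (θ' - ω) * (1 - ρ₀) ∧
        Window θ.γ ⊆ W ∧ θ.γ ≤ γ' ∧ (li F θ).κ ≤ κ ∧ θ' ≤ (li F θ).θ₅ ∧
        (Real.exp 1 * 9 * 64 * K₀ 64 8 ^ 2 * (C3 * ε₁) / (1 - ρ₀) * (δ + δ') + B) * (θ' - ω) /
            (θ' - (ω + Real.exp 1 * 9 * 64 * K₀ 64 8 ^ 2 * (C3 * ε₁) / (1 - ρ₀) * cH)) ≤ (li F θ).C₅) :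
    S_N18 (RRec₁₂ (readingOfRecord₁₂ (fun F θ => ReadingData.ofRecord F θ.τ9.M N (S F θ) (gauge F θ) (hg F θ)
      (fun k => transportRaw F k (avOfRecord F N (k + 1) 0)) (li F θ)) ℓ₃ ne2 ne1)) :=
  s_N18_readingOfRecord₁₂_of_envelopeOnW1Carriers _ ℓ₃ ne2 ne1 h

/-! ## §4 Honesty at the reading of record: the termless towers satisfy it outright — the statement is content through the towers -/

/-- **INHABITATION IS NOT CONTENT, AT THE READING OF RECORD** [honesty]: with every map AND the transport of record pinned, the statement of record is still a
statement about the TOWERS: for W1's TERMLESS towers (`Node00.W1.termlessTower`: no (2.11) indices, `H ≡ 0`, so every (2.13) term vanishes —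
`Node00.W1.functionalC_termlessTower`) and letter inputs with `0 ≤ θ₅`, `0 ≤ C₅` it holds OUTRIGHT (`|0 − 0| ≤ C₅·θ₅^j·e^{−κ d}`), whatever the gauge and the other
components.  So `S_N18` at the reading of record is NE5's content exactly for the towers OF RECORD — the (2.14) terms of the construction (N10's Lemmas 1–3
objects; definer ∕ NODE O lane) — and a skeleton quoting it NAMES its towers. [cite: Balaban1988RG2Cluster, (2.11) and (2.13) p.14 (bookkeeping; display of degeneracy)] -/
theorem s_N18_readingOfRecord₁₂_ofRecord_termless (hθ₅ : ∀ (F : T4Family) (θ : Stage12Params F N), 0 ≤ (li F θ).θ₅)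
    (hC₅ : ∀ (F : T4Family) (θ : Stage12Params F N), 0 ≤ (li F θ).C₅) :
    S_N18 (RRec₁₂ (readingOfRecord₁₂ (fun F θ => ReadingData.ofRecord F θ.τ9.M N
      (fun k => Node00.W1.termlessTower (F.P k) (MatA N) θ.τ9.M) (gauge F θ) (hg F θ)
      (fun k => transportRaw F k (avOfRecord F N (k + 1) 0)) (li F θ)) ℓ₃ ne2 ne1)) := by
  refine (s_N18_readingOfRecord₁₂_ofRecord_iff _ gauge hg li ℓ₃ ne2 ne1).2 fun F D h k b _ _ g _ U X => ?_
  rw [Node00.W1.functionalC_termlessTower, Node00.W1.functionalC_termlessTower, Complex.zero_re, sub_self, abs_zero]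
  exact mul_nonneg (mul_nonneg (hC₅ F h.params) (pow_nonneg (hθ₅ F h.params) _)) (Real.exp_pos _).le

end OfRecord

end YMDAG.N18.W1Reading

end
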